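import Literature.NumberTheory.Rogawski1990.ArchBouazizClassMapG
import HarnessLib

/-!
# The class tube at a SCALAR CORNER: class data `ε`-close to `esymm3 (ζ,ζ,ζ)` forces every eigenvalue `ε′`-close to `ζ`
# (roots of a monic cubic near `(X − ζ)³`; Rogawski 1990 §3.6, §4.3; Bouaziz 1994 §5.1)

Topic `NumberTheory/Rogawski1990`; namespace `Literature.NumberTheory.Rogawski1990`.  THEOREMS ONLY (no `def`, no instance, no notation,
no axiom, no named fact, no `sorry`); lane `--kind proof --supports stmt-HodgeConjecture-24833`.  Cell `pub/hodgecm-mathlib`, crux H413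
(`stmt-HodgeConjecture-24833`), road «N8-INNER» ROAD B, brick (10)(C′) «CORNER EP PACKAGE» (census `CENSUS-N8-brick10Cprime-cornerEP.v1` §3 (T);
dealer LH2-plan (g1) 16:38:45Z «type `ArchCornerClassTube` (S) yourself»).  Author F0P3a-p03 (g25).  Count-neutral.

WHY.  ★ F1 `ArchBouazizClassTubeG` gives the class tube at REGULAR base classes (`cubicDisc b ≠ 0`); at the scalar corner `b_ζ = esymm3 (ζ,ζ,ζ)`
(`cubicDisc = 0`, the most degenerate point) the tube statement is the continuity of the ROOTS of a monic cubic at a triple root: if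
`dist (esymm3 λ) (esymm3 (ζ,ζ,ζ)) ≤ δ ≤ 1` (sup distance on `ℂ × ℂ × ℂ`, `‖ζ‖ = 1`) then every `λ_i` satisfies `‖λ_i − ζ‖³ ≤ 31 δ` — because
`λ_i` is a root of `X³ − σ₁X² + σ₂X − σ₃` (Vieta), so `(λ_i − ζ)³ = (σ₁ − 3ζ)λ_i² − (σ₂ − 3ζ²)λ_i + (σ₃ − ζ³)`, and `‖λ_i‖ < 5` by Cauchy's root bound.
Consequently (`bzClassMapG S′ c w = esymm3 (chartEigG S′ c w)` by `rfl`): for every `ε > 0` there is `δ > 0` with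
`dist (bzClassMapG S′ c w) (esymm3 (ζ,ζ,ζ)) < δ → ∀ i, ‖chartEigG S′ c w i − ζ‖ < ε` — at a SPLIT place this says `|x|` is small and both phases are
near `ζ` (the (B2′) vanishing tube of the central generator), at a COMPACT place that the three unit eigenvalues are near `ζ` (the corner
neighbourhood of the gluing ∕ Glaeser step).
HONEST LABEL: HC_CM is proved only modulo the 7 printed citations (2 remaining: hLiu418 = `stmt-HodgeConjecture-24832`, h413 =
`stmt-HodgeConjecture-24833`) until rung 0 closes; elementary, count-neutral.

## References
* [Rogawski1990] J. D. Rogawski, *Automorphic Representations of Unitary Groups in Three Variables*, Ann. of Math. Stud. 123 (1990), §3.6 p. 28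
  (classes by characteristic polynomial), §4.3 p. 42.
* [Bouaziz1994IntegralesOrbitales] A. Bouaziz, *Intégrales orbitales sur les groupes de Lie réductifs*, Ann. Sci. ÉNS (4) 27 (1994), §5.1 p. 588
  (neighbourhoods of a base class).
-/

set_option autoImplicit false

noncomputable section

open Complex Metric
open Literature.NumberTheory.Automorphic Literature.NumberTheory.Automorphic.UnitaryGroup Literature.NumberTheory.Automorphic.ArchCartan

namespace Literature.NumberTheory.Rogawski1990

/-! ## §1 Roots of a monic cubic near a triple root -/

section Roots

/-- Vieta at a root: each `λ_i` is a root of `X³ − σ₁X² + σ₂X − σ₃`, `(σ₁,σ₂,σ₃) = esymm3 λ`. [cite: Rogawski1990, §3.6 p. 28] -/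
theorem pow_three_eq_of_esymm3 (l : Fin 3 → ℂ) (i : Fin 3) :
    l i ^ 3 = (esymm3 l).1 * l i ^ 2 - (esymm3 l).2.1 * l i + (esymm3 l).2.2 := by
  simp only [esymm3]
  fin_cases i <;> simp <;> ring

/-- The class data of the scalar triple. [cite: Rogawski1990, §3.6 p. 28] -/
theorem esymm3_const (ζ : ℂ) : esymm3 (fun _ : Fin 3 => ζ) = (3 * ζ, 3 * ζ ^ 2, ζ ^ 3) := by
  simp only [esymm3]
  refine Prod.ext ?_ (Prod.ext ?_ ?_) <;> simp <;> ring

/-- The cube of the deviation from `ζ` in terms of the deviation of the class data (the key identity). [cite: Rogawski1990, §3.6 p. 28] -/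
theorem sub_pow_three_eq_of_esymm3 (l : Fin 3 → ℂ) (ζ : ℂ) (i : Fin 3) :
    (l i - ζ) ^ 3 = ((esymm3 l).1 - 3 * ζ) * l i ^ 2 - ((esymm3 l).2.1 - 3 * ζ ^ 2) * l i + ((esymm3 l).2.2 - ζ ^ 3) := by
  have h := pow_three_eq_of_esymm3 l i
  linear_combination h

/-- **Cauchy's root bound near the corner**: if the class data are within `1` of `(3ζ, 3ζ², ζ³)`, `‖ζ‖ = 1`, then every eigenvalue has norm `< 5`.
[cite: Rogawski1990, §3.6 p. 28] -/
theorem norm_lt_five_of_dist_esymm3_le_one {l : Fin 3 → ℂ} {ζ : ℂ} (hζ : ‖ζ‖ = 1)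
    (h : dist (esymm3 l) (esymm3 fun _ : Fin 3 => ζ) ≤ 1) (i : Fin 3) : ‖l i‖ < 5 := by
  rw [esymm3_const] at h
  have h1 : ‖(esymm3 l).1 - 3 * ζ‖ ≤ 1 := by
    rw [← dist_eq_norm]; refine le_trans ?_ h; rw [Prod.dist_eq]; exact le_max_left _ _
  have h2 : ‖(esymm3 l).2.1 - 3 * ζ ^ 2‖ ≤ 1 := by
    rw [← dist_eq_norm]; refine le_trans ?_ h; rw [Prod.dist_eq, Prod.dist_eq]
    exact (le_max_left _ _).trans (le_max_right _ _)
  have h3 : ‖(esymm3 l).2.2 - ζ ^ 3‖ ≤ 1 := by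
    rw [← dist_eq_norm]; refine le_trans ?_ h; rw [Prod.dist_eq, Prod.dist_eq]
    exact (le_max_right _ _).trans (le_max_right _ _)
  -- coefficient bounds
  have hc1 : ‖(esymm3 l).1‖ ≤ 4 := by
    have : ‖(esymm3 l).1‖ ≤ ‖(esymm3 l).1 - 3 * ζ‖ + ‖3 * ζ‖ := norm_le_norm_sub_add _ _
    rw [norm_mul, hζ] at this; norm_num at this; linarith
  have hc2 : ‖(esymm3 l).2.1‖ ≤ 4 := by
    have : ‖(esymm3 l).2.1‖ ≤ ‖(esymm3 l).2.1 - 3 * ζ ^ 2‖ + ‖3 * ζ ^ 2‖ := norm_le_norm_sub_add _ _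
    rw [norm_mul, norm_pow, hζ] at this; norm_num at this; linarith
  have hc3 : ‖(esymm3 l).2.2‖ ≤ 2 := by
    have : ‖(esymm3 l).2.2‖ ≤ ‖(esymm3 l).2.2 - ζ ^ 3‖ + ‖ζ ^ 3‖ := norm_le_norm_sub_add _ _
    rw [norm_pow, hζ] at this; norm_num at this; linarith
  -- Cauchy: if `‖λ‖ ≥ 5` then `‖λ‖³ ≤ 4‖λ‖² + 4‖λ‖ + 2 < ‖λ‖³`
  by_contra hge
  push Not at hge
  set r : ℝ := ‖l i‖ with hr
  have hv := pow_three_eq_of_esymm3 l i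
  have hbound : r ^ 3 ≤ 4 * r ^ 2 + 4 * r + 2 := by
    have : ‖l i ^ 3‖ ≤ ‖(esymm3 l).1 * l i ^ 2‖ + ‖(esymm3 l).2.1 * l i‖ + ‖(esymm3 l).2.2‖ := by
      rw [hv]; exact (norm_add_le _ _).trans (add_le_add (norm_sub_le _ _) le_rfl)
    rw [norm_pow, norm_mul, norm_mul, norm_pow] at this
    have hr0 : 0 ≤ r := norm_nonneg _
    nlinarith [mul_le_mul_of_nonneg_right hc1 (pow_nonneg hr0 2), mul_le_mul_of_nonneg_right hc2 hr0]
  nlinarith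

/-- **Roots near a triple root**: `dist (esymm3 λ) (esymm3 (ζ,ζ,ζ)) ≤ δ ≤ 1`, `‖ζ‖ = 1` ⇒ `‖λ_i − ζ‖³ ≤ 31 δ`.
[cite: Rogawski1990, §3.6 p. 28] [cite: Bouaziz1994IntegralesOrbitales, §5.1 p. 588] -/
theorem norm_sub_pow_three_le_of_dist_esymm3_le {l : Fin 3 → ℂ} {ζ : ℂ} (hζ : ‖ζ‖ = 1) {δ : ℝ} (hδ1 : δ ≤ 1)
    (h : dist (esymm3 l) (esymm3 fun _ : Fin 3 => ζ) ≤ δ) (i : Fin 3) : ‖l i - ζ‖ ^ 3 ≤ 31 * δ := by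
  have h5 := norm_lt_five_of_dist_esymm3_le_one hζ (h.trans hδ1) i
  have hδ0 : 0 ≤ δ := dist_nonneg.trans h
  rw [esymm3_const] at h
  have h1 : ‖(esymm3 l).1 - 3 * ζ‖ ≤ δ := by
    rw [← dist_eq_norm]; refine le_trans ?_ h; rw [Prod.dist_eq]; exact le_max_left _ _
  have h2 : ‖(esymm3 l).2.1 - 3 * ζ ^ 2‖ ≤ δ := by
    rw [← dist_eq_norm]; refine le_trans ?_ h; rw [Prod.dist_eq, Prod.dist_eq]
    exact (le_max_left _ _).trans (le_max_right _ _)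
  have h3 : ‖(esymm3 l).2.2 - ζ ^ 3‖ ≤ δ := by
    rw [← dist_eq_norm]; refine le_trans ?_ h; rw [Prod.dist_eq, Prod.dist_eq]
    exact (le_max_right _ _).trans (le_max_right _ _)
  rw [← norm_pow, sub_pow_three_eq_of_esymm3 l ζ i]
  have hr0 : 0 ≤ ‖l i‖ := norm_nonneg _
  calc ‖((esymm3 l).1 - 3 * ζ) * l i ^ 2 - ((esymm3 l).2.1 - 3 * ζ ^ 2) * l i + ((esymm3 l).2.2 - ζ ^ 3)‖
      ≤ ‖((esymm3 l).1 - 3 * ζ) * l i ^ 2‖ + ‖((esymm3 l).2.1 - 3 * ζ ^ 2) * l i‖ + ‖(esymm3 l).2.2 - ζ ^ 3‖ :=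
        (norm_add_le _ _).trans (add_le_add (norm_sub_le _ _) le_rfl)
    _ = ‖(esymm3 l).1 - 3 * ζ‖ * ‖l i‖ ^ 2 + ‖(esymm3 l).2.1 - 3 * ζ ^ 2‖ * ‖l i‖ + ‖(esymm3 l).2.2 - ζ ^ 3‖ := by
        rw [norm_mul, norm_mul, norm_pow]
    _ ≤ δ * 5 ^ 2 + δ * 5 + δ := by
        gcongr
    _ = 31 * δ := by ring

/-- **`ε`–`δ` form**: for `‖ζ‖ = 1` and `ε > 0` there is `δ > 0` such that class data `δ`-close to `esymm3 (ζ,ζ,ζ)` force all three eigenvalues `ε`-close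
to `ζ`. [cite: Rogawski1990, §3.6 p. 28] [cite: Bouaziz1994IntegralesOrbitales, §5.1 p. 588] -/
theorem exists_forall_norm_sub_lt_of_dist_esymm3_lt {ζ : ℂ} (hζ : ‖ζ‖ = 1) {ε : ℝ} (hε : 0 < ε) :
    ∃ δ : ℝ, 0 < δ ∧ ∀ l : Fin 3 → ℂ, dist (esymm3 l) (esymm3 fun _ : Fin 3 => ζ) < δ → ∀ i, ‖l i - ζ‖ < ε := by
  refine ⟨min 1 (ε ^ 3 / 32), lt_min one_pos (by positivity), fun l hl i => ?_⟩
  have hle := norm_sub_pow_three_le_of_dist_esymm3_le hζ (min_le_left _ _) hl.le i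
  have hlt : ‖l i - ζ‖ ^ 3 < ε ^ 3 := by
    have : 31 * min 1 (ε ^ 3 / 32) < ε ^ 3 := by
      have hm : min 1 (ε ^ 3 / 32) ≤ ε ^ 3 / 32 := min_le_right _ _
      have hp : 0 < ε ^ 3 := by positivity
      linarith
    exact hle.trans_lt this
  exact lt_of_pow_lt_pow_left₀ 3 hε.le hlt

end Roots

/-! ## §2 The class tube at a scalar corner, both chart types -/

section Tube

variable {W : Type*} [DecidableEq W]

/-- **THE CLASS TUBE AT A SCALAR CORNER.**  For `‖ζ‖ = 1` and `ε > 0` there is `δ > 0` such that at every chart `(S′, c)` and place `w`: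
`dist (bzClassMapG S′ c w) (esymm3 (ζ,ζ,ζ)) < δ → ∀ i, ‖chartEigG S′ c w i − ζ‖ < ε` — at a split place (`w ∈ S′`: `chartEigG = boostEig (c w)`) this puts
`e^{±x+iθ}` and `e^{iφ}` within `ε` of `ζ`, at a compact place the three unit eigenvalues `e^{i c w k}`.
[cite: Bouaziz1994IntegralesOrbitales, §5.1 p. 588] [cite: Rogawski1990, §3.6 p. 28] -/
theorem exists_cornerClassTubeG {ζ : ℂ} (hζ : ‖ζ‖ = 1) {ε : ℝ} (hε : 0 < ε) :
    ∃ δ : ℝ, 0 < δ ∧ ∀ (S' : Finset W) (c : W → Fin 3 → ℝ) (w : W),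
      dist (bzClassMapG S' c w) (esymm3 fun _ : Fin 3 => ζ) < δ → ∀ i, ‖chartEigG S' c w i - ζ‖ < ε := by
  obtain ⟨δ, hδ, h⟩ := exists_forall_norm_sub_lt_of_dist_esymm3_lt hζ hε
  exact ⟨δ, hδ, fun S' c w hd i => h (chartEigG S' c w) hd i⟩

/-- **Split place reading of the tube**: at `w ∈ S′` the boost coordinate is small and both phases are near `ζ`:
`|Real.exp (c w 0) − 1| < ε`, `‖cexp (c w 1 · I) − ζ‖ < ε`, `‖cexp ((c w 0 + c w 2·I)) − ζ‖ < ε`, `‖cexp ((−c w 0 + c w 2·I)) − ζ‖ < ε`.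
[cite: Rogawski1990, §3.6 p. 28] -/
theorem exists_cornerClassTubeG_split {ζ : ℂ} (hζ : ‖ζ‖ = 1) {ε : ℝ} (hε : 0 < ε) :
    ∃ δ : ℝ, 0 < δ ∧ ∀ (S' : Finset W) (c : W → Fin 3 → ℝ) (w : W), w ∈ S' →
      dist (bzClassMapG S' c w) (esymm3 fun _ : Fin 3 => ζ) < δ →
        |Real.exp (c w 0) - 1| < ε ∧ ‖Complex.exp ((c w 1 : ℂ) * I) - ζ‖ < ε ∧
          ‖Complex.exp ((c w 0 : ℂ) + (c w 2 : ℂ) * I) - ζ‖ < ε ∧ ‖Complex.exp (-(c w 0 : ℂ) + (c w 2 : ℂ) * I) - ζ‖ < ε := by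
  obtain ⟨δ, hδ, h⟩ := exists_cornerClassTubeG (W := W) hζ hε
  refine ⟨δ, hδ, fun S' c w hw hd => ?_⟩
  have h' := h S' c w hd
  simp only [chartEigG_of_mem hw, boostEig] at h'
  have h0 := h' 0
  have h1 := h' 1
  have h2 := h' 2
  simp only [Matrix.cons_val_zero, Matrix.cons_val_one, Matrix.cons_val_two, Matrix.head_cons, Matrix.tail_cons] at h0 h1 h2
  refine ⟨?_, h1, h0, h2⟩
  -- `|e^x − 1| = |‖e^{x+iθ}‖ − ‖ζ‖| ≤ ‖e^{x+iθ} − ζ‖`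
  have hn : ‖Complex.exp ((c w 0 : ℂ) + (c w 2 : ℂ) * I)‖ = Real.exp (c w 0) := by
    rw [Complex.norm_exp]
    simp
  have := abs_norm_sub_norm_le (Complex.exp ((c w 0 : ℂ) + (c w 2 : ℂ) * I)) ζ
  rw [hn, hζ] at this
  exact this.trans_lt h0

/-- **Compact place reading of the tube**: at `w ∉ S′` the three unit eigenvalues are near `ζ`: `‖cexp (c w k · I) − ζ‖ < ε` for `k = 0,1,2`.
[cite: Rogawski1990, §3.6 p. 28] -/
theorem exists_cornerClassTubeG_compact {ζ : ℂ} (hζ : ‖ζ‖ = 1) {ε : ℝ} (hε : 0 < ε) :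
    ∃ δ : ℝ, 0 < δ ∧ ∀ (S' : Finset W) (c : W → Fin 3 → ℝ) (w : W), w ∉ S' →
      dist (bzClassMapG S' c w) (esymm3 fun _ : Fin 3 => ζ) < δ → ∀ k, ‖Complex.exp ((c w k : ℂ) * I) - ζ‖ < ε := by
  obtain ⟨δ, hδ, h⟩ := exists_cornerClassTubeG (W := W) hζ hε
  refine ⟨δ, hδ, fun S' c w hw hd k => ?_⟩
  have h' := h S' c w hd k
  rwa [chartEigG_of_not_mem hw] at h'

end Tube

end Literature.NumberTheory.Rogawski1990

end
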